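import Summits.ABC.IUTFork.Cor312TeamAChain
import Summits.ABC.IUTFork.ForkInputStrip
import Summits.ABC.IUTFork.Cor312SoundInput
import Summits.ABC.IUTFork.Cor312LogKummerGlobal
import HarnessLib

/-!
# [IUTchIII] Cor. 3.12 — TEAM A full-chain census re-cut at the GAP OF RECORD (LEVEL 0 `GapGlobal`, LEVEL 1 `SoundAtInput`)

Record-only, proof-only file (D-0012) of the abc-iut cell (D-0067 discharge wave 4, seat abc-iut-w4-d021; bears on
rows A-4/A-5 of `HOME/plan/C312-TEAMS.md` and on the 11:30Z TEAM A RESULT line,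
`HOME/staging/c312/c312-10/adjudication-line-1130Z-FINAL.txt`). TAKES NO SIDE on [IUTchIII] Cor. 3.12.

S. Mochizuki, *Inter-universal Teichmüller theory III*, kurims manuscript (May 2020), Cor. 3.12, proof Step (xi-f)
p. 184 l. 19–29 [cite: Mochizuki2012, III Cor 3.12 p.184]; claim key `Mochizuki2012` DISPUTED (D-0012).

WHY THIS FILE. The landed full-chain census `Cor312Proof.teamA_statement_end_to_end` (Cor312TeamAChain.lean, p412737,
abc-iut-c312-9) composes all twenty `Step.Holds` lemmas with c312-2's real edges and closes the printed `Statement`;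
its ONE reading-level hypothesis `hread` is wired to the PER-PACKET funnel (READING 0,
`∀ i v_ℚ, qLocal ≤ thetaLocal`, via `Cor312Vol.statement_of_qLocal_le`) — a member of the SUFFICIENT catalogue that the
adjudication record itself grades STRONGER-THAN-PRINT (skel XXIV `Cor312Vol.LocalGlobal.fork`, plan/ADJUDICATION-SPEC.md
§2 (G1′)). The GapA OF RECORD is GLOBAL: LEVEL 0 = `InputStrip.StripAlgorithm.GapGlobal` (skel XXV, p412442; GAP-LEDGER
G-c312-9-1 + SUPPLEMENT), LEVEL 1 = `Cor312Vol.SoundAtInput` (p413249). By c312-7's `realEdges_verbatim_iff`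
(Cor312VerbatimReadings.lean) the real edges of the chain are EXACTLY the implication
`O constitutesConstruction → P.Statement`, so the census is PARAMETRIC in the closing edge. This file records that
fact as a theorem and instantiates it at the two levels of record, so that the (G1) "full-chain census" and the
(G1) "edge of record" of the 11:30Z line are ONE kernel object:

* `teamA_statement_end_to_end_of_edge` — the census with the closing edge abstracted: the nineteen content
  implications + bridge hypotheses + `|log(q)| > 0` + ANY implication `O constitutesConstruction → P.Statement`
  give the printed `Statement` (the edge is where every sufficient reading — R0/R2/R3/R4, VolumeTransport,
  GapGlobal, SoundAtInput — plugs in; nothing else in the chain depends on the choice).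
* `teamA_statement_end_to_end_of_gapGlobal` — LEVEL 0: the same census whose one open slot is
  `O constitutesConstruction → A.GapGlobal` for a strip-algorithm presentation `A` of the setting (closing edge
  `InputStrip.StripAlgorithm.statement_of_gapGlobal`).
* `teamA_statement_end_to_end_of_soundAtInput` — LEVEL 1: the one open slot is
  `O constitutesConstruction → SoundAtInput P G` for a value-group gluing `G` (closing edge
  `Cor312Vol.statement_of_soundAtInput`; carries the STRONGER-THAN-PRINT / off-pilot flag of the SUPPLEMENT).
* `teamA_statement_end_to_end_of_globalVolumeTransport` — TEAM B's (G1′)-admissible GLOBAL input (row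
  G-c312-11-1): the one open slot is `O constitutesConstruction → GlobalVolumeTransport P`, closing edge
  `Cor312Vol.GlobalVolumeTransport.statement_of` (needs `ThetaRegionsAdm`, as on the log-Kummer route) — the A↔B
  unification at the level of the chain census.
* `teamA_edge_of_qLocal_le` — bookkeeping: the landed R0 wiring is the `_of_edge` form at
  `Cor312Vol.statement_of_qLocal_le` (so `teamA_statement_end_to_end` = `_of_edge ∘ R0`).

Everything here is composition of LANDED theorems (no new definition, no new hypothesis shape beyond replacing
`hread`); the hypothesis list is copied verbatim from `teamA_statement_end_to_end` so that hypaudit reads the same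
census. HONEST FRAMING: typed ≠ proved; the open slot is the disputed inference in each form; whether [IUTchIII]
Thm 3.11 licenses it is exactly the Scholze–Stix / Mochizuki disagreement and is not decided here.
-/

namespace Summit.ABC

namespace IUTFork

namespace Cor312Proof

open Locus Obs Thm311 Cor312 Cor312Vol StepXI Literature.IUT.LogThetaLattice

variable {T : ThetaIndex} {S : Situation T} {P : Cor312.Setting S}

/-- **TEAM A END-TO-END, closing edge abstracted** ([IUTchIII] Cor. 3.12 proof, Steps (i)–(xii), p. 174–186; the
edge = (xi-f) p. 184 l. 19–29 read as "observation ⟹ the Corollary's inequality"): all twenty nodes composed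
(`teamA_chain`) with c312-2's real edges through the verbatim volumes; granting the bridge hypotheses, `|log(q)| > 0`
and ANY implication `O constitutesConstruction → P.Statement`, the printed `Statement` follows. By
`realEdges_verbatim_iff` that implication IS the real-edge content, so this is the most general form of the census:
every sufficient reading of (xi-f) enters only through `hedge`. [claim: Mochizuki2012, status: disputed] -/
theorem teamA_statement_end_to_end_of_edge (H : BridgeHyps P) (C : Column S.L)
    (D : ThetaLinkStrips P.LogLink P.Strip) {L : Locus → Prop} {O : Obs → Prop} (hL : ∀ c, L c)
    (hwlog : O .restrictToStrips) (hi1 : O .linkSplits) (hi2 : O .valueGroupMapsPilots)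
    (hii1 : O .unitsSubjectInd12) (hii2 : O .cyclotomesInsulated) (hiii : O .singleLinkNecessary)
    (hiv : O .singleLinkNecessary → O .verticalShiftSolved)
    (hv : O .linkSplits → O .unitsRelatedContainers ∧ O .frobeniusLikeRelatedToCoric)
    (hvi : O .frobeniusLikeRelatedToCoric →
      O .logKummerViaGaloisEvaluation ∧ O .conjSyncLogLinkCompatible ∧ O .cycRigidityApproaches)
    (hvii : O .cycRigidityApproaches → O .symmetriesSeparate ∧ O .symmetriesMultiradial)
    (hviii : O .symmetriesSeparate → O .conjugacyIndetResolved)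
    (hix : O .symmetriesSeparate → O .unitsRelatedContainers → O .fmodTranslation)
    (hIndAdm : ∀ Φ ∈ S.L.Ind1Family ∪ S.L.Ind2Family, ∀ (j : T.Label) (vQ : T.VQ)
      (A : Set (S.L.Packet j vQ)), (S.D P.n).Adm j vQ A ↔ (S.D P.n).Adm j vQ (Φ j vQ '' A))
    (hIndVol : (S.D P.n).LogvolInvariant)
    (hMono : ∀ (j : T.Label) (vQ : T.VQ) (A B : Set (S.L.Packet j vQ)),
      (S.D P.n).Adm j vQ A → (S.D P.n).Adm j vQ B → A ⊆ B →
        (S.D P.n).logvol j vQ A ≤ (S.D P.n).logvol j vQ B)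
    (hKumA : C.KummerA (S.D P.n))
    (hO1 : StepX.KummerDetach P → O .kummerDetachmentInd123)
    (hO2 : StepX.LogvolCoarse P → O .logvolInvariantInequality)
    (hO3 : StepX.LogvolLogLink P C → O .logvolLogLinkCompatible)
    (hO4 : StepX.TensorMultZ P → O .tensorIdentifiesMultZ)
    {VG CIPL CSHE : Prop} (hVG : O .valueGroupMapsPilots → VG)
    (hNE : ∀ n m : ℤ, Nonempty (P.IsoS (D.stripLGP (P.lattice.logLink n (m - 1)))
      (D.stripDelta (P.lattice.theater (n + 1) m))))
    (hOxia : LinkAsGluing P D VG → O .linkAsGluing)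
    (hIPL : L .IPL → CIPL) (hSHE : L .SHE → CSHE)
    (hOb1 : OutputIPLSHE CIPL CSHE → O .outputSatisfiesIPLSHE)
    (hOb2 : ValueGroupFullPoly P D → O .valueGroupLinkFullPolyIso)
    (hOb3 : OnlyQualitative → O .onlyQualitative)
    (hIPLrev : O .outputSatisfiesIPLSHE → OutputIPLSHE CIPL CSHE)
    (hOc1 : DisplayXIc P D CIPL CSHE → O .displayXIc)
    (hOc2 : HullComparable P → O .hullGivesVectorBundles)
    (hXIde : P.AgreesXIde O) (hq : P.AbsLogQPos)
    (hgap : O .displayXIe → O .sheMeansFixedValue → O .constitutesConstruction)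
    (htw : O .twoEquivalentWays) (hh : O .noNthPower) (hx : O .globalFrobenioidsNeeded)
    (hedge : O .constitutesConstruction → P.Statement) :
    P.Statement :=
  (verbatimVolumes_cor312_iff H hq).1
    (cor312_of_chain hL
      (teamA_chain C D hwlog hi1 hi2 hii1 hii2 hiii hiv hv hvi hvii hviii hix hIndAdm hIndVol hMono
        hKumA hO1 hO2 hO3 hO4 hVG hNE hOxia hIPL hSHE hOb1 hOb2 hOb3 hIPLrev hOc1 hOc2 hXIde
        H.finite hq hgap htw hh hx)
      ((realEdges_verbatim_iff H hq O).2 hedge))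

/-- **TEAM A END-TO-END at LEVEL 0 (the GapA of record)**: the census whose one open slot is
"(xi-f)'s observation ⟹ soundness of the multiradial algorithm at the link-identified input prime-strip",
`O constitutesConstruction → A.GapGlobal` (skel XXV `InputStrip.StripAlgorithm.GapGlobal`, GAP-LEDGER G-c312-9-1,
print-faithful at p. 184 l. 19–29), for any strip-algorithm presentation `A` of the setting; closing edge
`InputStrip.StripAlgorithm.statement_of_gapGlobal`. [claim: Mochizuki2012, status: disputed] -/
theorem teamA_statement_end_to_end_of_gapGlobal (H : BridgeHyps P) (C : Column S.L)
    (D : ThetaLinkStrips P.LogLink P.Strip) (A : InputStrip.StripAlgorithm P)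
    {L : Locus → Prop} {O : Obs → Prop} (hL : ∀ c, L c)
    (hwlog : O .restrictToStrips) (hi1 : O .linkSplits) (hi2 : O .valueGroupMapsPilots)
    (hii1 : O .unitsSubjectInd12) (hii2 : O .cyclotomesInsulated) (hiii : O .singleLinkNecessary)
    (hiv : O .singleLinkNecessary → O .verticalShiftSolved)
    (hv : O .linkSplits → O .unitsRelatedContainers ∧ O .frobeniusLikeRelatedToCoric)
    (hvi : O .frobeniusLikeRelatedToCoric →
      O .logKummerViaGaloisEvaluation ∧ O .conjSyncLogLinkCompatible ∧ O .cycRigidityApproaches)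
    (hvii : O .cycRigidityApproaches → O .symmetriesSeparate ∧ O .symmetriesMultiradial)
    (hviii : O .symmetriesSeparate → O .conjugacyIndetResolved)
    (hix : O .symmetriesSeparate → O .unitsRelatedContainers → O .fmodTranslation)
    (hIndAdm : ∀ Φ ∈ S.L.Ind1Family ∪ S.L.Ind2Family, ∀ (j : T.Label) (vQ : T.VQ)
      (A : Set (S.L.Packet j vQ)), (S.D P.n).Adm j vQ A ↔ (S.D P.n).Adm j vQ (Φ j vQ '' A))
    (hIndVol : (S.D P.n).LogvolInvariant)
    (hMono : ∀ (j : T.Label) (vQ : T.VQ) (A B : Set (S.L.Packet j vQ)),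
      (S.D P.n).Adm j vQ A → (S.D P.n).Adm j vQ B → A ⊆ B →
        (S.D P.n).logvol j vQ A ≤ (S.D P.n).logvol j vQ B)
    (hKumA : C.KummerA (S.D P.n))
    (hO1 : StepX.KummerDetach P → O .kummerDetachmentInd123)
    (hO2 : StepX.LogvolCoarse P → O .logvolInvariantInequality)
    (hO3 : StepX.LogvolLogLink P C → O .logvolLogLinkCompatible)
    (hO4 : StepX.TensorMultZ P → O .tensorIdentifiesMultZ)
    {VG CIPL CSHE : Prop} (hVG : O .valueGroupMapsPilots → VG)
    (hNE : ∀ n m : ℤ, Nonempty (P.IsoS (D.stripLGP (P.lattice.logLink n (m - 1)))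
      (D.stripDelta (P.lattice.theater (n + 1) m))))
    (hOxia : LinkAsGluing P D VG → O .linkAsGluing)
    (hIPL : L .IPL → CIPL) (hSHE : L .SHE → CSHE)
    (hOb1 : OutputIPLSHE CIPL CSHE → O .outputSatisfiesIPLSHE)
    (hOb2 : ValueGroupFullPoly P D → O .valueGroupLinkFullPolyIso)
    (hOb3 : OnlyQualitative → O .onlyQualitative)
    (hIPLrev : O .outputSatisfiesIPLSHE → OutputIPLSHE CIPL CSHE)
    (hOc1 : DisplayXIc P D CIPL CSHE → O .displayXIc)
    (hOc2 : HullComparable P → O .hullGivesVectorBundles)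
    (hXIde : P.AgreesXIde O) (hq : P.AbsLogQPos)
    (hgap : O .displayXIe → O .sheMeansFixedValue → O .constitutesConstruction)
    (htw : O .twoEquivalentWays) (hh : O .noNthPower) (hx : O .globalFrobenioidsNeeded)
    (hread : O .constitutesConstruction → A.GapGlobal) :
    P.Statement :=
  teamA_statement_end_to_end_of_edge H C D hL hwlog hi1 hi2 hii1 hii2 hiii hiv hv hvi hvii hviii hix
    hIndAdm hIndVol hMono hKumA hO1 hO2 hO3 hO4 hVG hNE hOxia hIPL hSHE hOb1 hOb2 hOb3 hIPLrev hOc1 hOc2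
    hXIde hq hgap htw hh hx fun hc => A.statement_of_gapGlobal H (hread hc)

/-- **TEAM A END-TO-END at LEVEL 1**: the census whose one open slot is
"(xi-f)'s observation ⟹ soundness of the algorithm at EVERY input of the value-group gluing `G`",
`O constitutesConstruction → SoundAtInput P G` (GAP-LEDGER G-c312-9-1 as filed; = LEVEL 0 ∧ `SoundOffPilot` by
`Cor312Vol.soundAtInput_iff_statement_and_offPilot`, flag STRONGER-THAN-PRINT per the SUPPLEMENT); closing edge
`Cor312Vol.statement_of_soundAtInput`. [claim: Mochizuki2012, status: disputed] -/
theorem teamA_statement_end_to_end_of_soundAtInput (H : BridgeHyps P) (C : Column S.L)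
    (D : ThetaLinkStrips P.LogLink P.Strip) (G : LinkGluing P)
    {L : Locus → Prop} {O : Obs → Prop} (hL : ∀ c, L c)
    (hwlog : O .restrictToStrips) (hi1 : O .linkSplits) (hi2 : O .valueGroupMapsPilots)
    (hii1 : O .unitsSubjectInd12) (hii2 : O .cyclotomesInsulated) (hiii : O .singleLinkNecessary)
    (hiv : O .singleLinkNecessary → O .verticalShiftSolved)
    (hv : O .linkSplits → O .unitsRelatedContainers ∧ O .frobeniusLikeRelatedToCoric)
    (hvi : O .frobeniusLikeRelatedToCoric →
      O .logKummerViaGaloisEvaluation ∧ O .conjSyncLogLinkCompatible ∧ O .cycRigidityApproaches)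
    (hvii : O .cycRigidityApproaches → O .symmetriesSeparate ∧ O .symmetriesMultiradial)
    (hviii : O .symmetriesSeparate → O .conjugacyIndetResolved)
    (hix : O .symmetriesSeparate → O .unitsRelatedContainers → O .fmodTranslation)
    (hIndAdm : ∀ Φ ∈ S.L.Ind1Family ∪ S.L.Ind2Family, ∀ (j : T.Label) (vQ : T.VQ)
      (A : Set (S.L.Packet j vQ)), (S.D P.n).Adm j vQ A ↔ (S.D P.n).Adm j vQ (Φ j vQ '' A))
    (hIndVol : (S.D P.n).LogvolInvariant)
    (hMono : ∀ (j : T.Label) (vQ : T.VQ) (A B : Set (S.L.Packet j vQ)),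
      (S.D P.n).Adm j vQ A → (S.D P.n).Adm j vQ B → A ⊆ B →
        (S.D P.n).logvol j vQ A ≤ (S.D P.n).logvol j vQ B)
    (hKumA : C.KummerA (S.D P.n))
    (hO1 : StepX.KummerDetach P → O .kummerDetachmentInd123)
    (hO2 : StepX.LogvolCoarse P → O .logvolInvariantInequality)
    (hO3 : StepX.LogvolLogLink P C → O .logvolLogLinkCompatible)
    (hO4 : StepX.TensorMultZ P → O .tensorIdentifiesMultZ)
    {VG CIPL CSHE : Prop} (hVG : O .valueGroupMapsPilots → VG)
    (hNE : ∀ n m : ℤ, Nonempty (P.IsoS (D.stripLGP (P.lattice.logLink n (m - 1)))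
      (D.stripDelta (P.lattice.theater (n + 1) m))))
    (hOxia : LinkAsGluing P D VG → O .linkAsGluing)
    (hIPL : L .IPL → CIPL) (hSHE : L .SHE → CSHE)
    (hOb1 : OutputIPLSHE CIPL CSHE → O .outputSatisfiesIPLSHE)
    (hOb2 : ValueGroupFullPoly P D → O .valueGroupLinkFullPolyIso)
    (hOb3 : OnlyQualitative → O .onlyQualitative)
    (hIPLrev : O .outputSatisfiesIPLSHE → OutputIPLSHE CIPL CSHE)
    (hOc1 : DisplayXIc P D CIPL CSHE → O .displayXIc)
    (hOc2 : HullComparable P → O .hullGivesVectorBundles)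
    (hXIde : P.AgreesXIde O) (hq : P.AbsLogQPos)
    (hgap : O .displayXIe → O .sheMeansFixedValue → O .constitutesConstruction)
    (htw : O .twoEquivalentWays) (hh : O .noNthPower) (hx : O .globalFrobenioidsNeeded)
    (hread : O .constitutesConstruction → SoundAtInput P G) :
    P.Statement :=
  teamA_statement_end_to_end_of_edge H C D hL hwlog hi1 hi2 hii1 hii2 hiii hiv hv hvi hvii hviii hix
    hIndAdm hIndVol hMono hKumA hO1 hO2 hO3 hO4 hVG hNE hOxia hIPL hSHE hOb1 hOb2 hOb3 hIPLrev hOc1 hOc2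
    hXIde hq hgap htw hh hx fun hc => statement_of_soundAtInput P G (hread hc)

/-- **TEAM A END-TO-END at TEAM B's global input**: the census whose one open slot is
"(xi-f)'s observation ⟹ the global (xi-g) comparison" `O constitutesConstruction → GlobalVolumeTransport P`
(GAP-LEDGER G-c312-11-1, the (G1′)-admissible GLOBAL form of the log-Kummer route input; p414039); closing edge
`Cor312Vol.GlobalVolumeTransport.statement_of`, which needs the route's admissibility `ThetaRegionsAdm`.
[claim: Mochizuki2012, status: disputed] -/
theorem teamA_statement_end_to_end_of_globalVolumeTransport (H : BridgeHyps P) (hadm : ThetaRegionsAdm P)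
    (C : Column S.L) (D : ThetaLinkStrips P.LogLink P.Strip)
    {L : Locus → Prop} {O : Obs → Prop} (hL : ∀ c, L c)
    (hwlog : O .restrictToStrips) (hi1 : O .linkSplits) (hi2 : O .valueGroupMapsPilots)
    (hii1 : O .unitsSubjectInd12) (hii2 : O .cyclotomesInsulated) (hiii : O .singleLinkNecessary)
    (hiv : O .singleLinkNecessary → O .verticalShiftSolved)
    (hv : O .linkSplits → O .unitsRelatedContainers ∧ O .frobeniusLikeRelatedToCoric)
    (hvi : O .frobeniusLikeRelatedToCoric →
      O .logKummerViaGaloisEvaluation ∧ O .conjSyncLogLinkCompatible ∧ O .cycRigidityApproaches)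
    (hvii : O .cycRigidityApproaches → O .symmetriesSeparate ∧ O .symmetriesMultiradial)
    (hviii : O .symmetriesSeparate → O .conjugacyIndetResolved)
    (hix : O .symmetriesSeparate → O .unitsRelatedContainers → O .fmodTranslation)
    (hIndAdm : ∀ Φ ∈ S.L.Ind1Family ∪ S.L.Ind2Family, ∀ (j : T.Label) (vQ : T.VQ)
      (A : Set (S.L.Packet j vQ)), (S.D P.n).Adm j vQ A ↔ (S.D P.n).Adm j vQ (Φ j vQ '' A))
    (hIndVol : (S.D P.n).LogvolInvariant)
    (hMono : ∀ (j : T.Label) (vQ : T.VQ) (A B : Set (S.L.Packet j vQ)),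
      (S.D P.n).Adm j vQ A → (S.D P.n).Adm j vQ B → A ⊆ B →
        (S.D P.n).logvol j vQ A ≤ (S.D P.n).logvol j vQ B)
    (hKumA : C.KummerA (S.D P.n))
    (hO1 : StepX.KummerDetach P → O .kummerDetachmentInd123)
    (hO2 : StepX.LogvolCoarse P → O .logvolInvariantInequality)
    (hO3 : StepX.LogvolLogLink P C → O .logvolLogLinkCompatible)
    (hO4 : StepX.TensorMultZ P → O .tensorIdentifiesMultZ)
    {VG CIPL CSHE : Prop} (hVG : O .valueGroupMapsPilots → VG)
    (hNE : ∀ n m : ℤ, Nonempty (P.IsoS (D.stripLGP (P.lattice.logLink n (m - 1)))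
      (D.stripDelta (P.lattice.theater (n + 1) m))))
    (hOxia : LinkAsGluing P D VG → O .linkAsGluing)
    (hIPL : L .IPL → CIPL) (hSHE : L .SHE → CSHE)
    (hOb1 : OutputIPLSHE CIPL CSHE → O .outputSatisfiesIPLSHE)
    (hOb2 : ValueGroupFullPoly P D → O .valueGroupLinkFullPolyIso)
    (hOb3 : OnlyQualitative → O .onlyQualitative)
    (hIPLrev : O .outputSatisfiesIPLSHE → OutputIPLSHE CIPL CSHE)
    (hOc1 : DisplayXIc P D CIPL CSHE → O .displayXIc)
    (hOc2 : HullComparable P → O .hullGivesVectorBundles)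
    (hXIde : P.AgreesXIde O) (hq : P.AbsLogQPos)
    (hgap : O .displayXIe → O .sheMeansFixedValue → O .constitutesConstruction)
    (htw : O .twoEquivalentWays) (hh : O .noNthPower) (hx : O .globalFrobenioidsNeeded)
    (hread : O .constitutesConstruction → GlobalVolumeTransport P) :
    P.Statement :=
  teamA_statement_end_to_end_of_edge H C D hL hwlog hi1 hi2 hii1 hii2 hiii hiv hv hvi hvii hviii hix
    hIndAdm hIndVol hMono hKumA hO1 hO2 hO3 hO4 hVG hNE hOxia hIPL hSHE hOb1 hOb2 hOb3 hIPLrev hOc1 hOc2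
    hXIde hq hgap htw hh hx fun hc => (hread hc).statement_of H hadm

/-- Bookkeeping: the landed R0 wiring of `teamA_statement_end_to_end` (per-packet funnel, STRONGER-THAN-PRINT per
skel XXIV) is an instance of the abstract edge — its closing edge is `Cor312Vol.statement_of_qLocal_le`. [folklore] -/
theorem teamA_edge_of_qLocal_le (H : BridgeHyps P) {O : Obs → Prop}
    (hread : O .constitutesConstruction →
      ∀ (i : Fin T.lstar) (vQ : T.VQ),
        P.qLocal (Setting.labelSucc i) vQ ≤ (P.thetaLocal (Setting.labelSucc i) vQ).untopD 0) :
    O .constitutesConstruction → P.Statement :=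
  fun hc => statement_of_qLocal_le H (hread hc)

/-- Bookkeeping: the LEVEL-0 edge, isolated. [folklore] -/
theorem teamA_edge_of_gapGlobal (H : BridgeHyps P) (A : InputStrip.StripAlgorithm P) {O : Obs → Prop}
    (hread : O .constitutesConstruction → A.GapGlobal) :
    O .constitutesConstruction → P.Statement :=
  fun hc => A.statement_of_gapGlobal H (hread hc)

/-- Bookkeeping: the LEVEL-1 edge, isolated (no bridge hypothesis needed). [folklore] -/
theorem teamA_edge_of_soundAtInput (G : LinkGluing P) {O : Obs → Prop}
    (hread : O .constitutesConstruction → SoundAtInput P G) :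
    O .constitutesConstruction → P.Statement :=
  fun hc => statement_of_soundAtInput P G (hread hc)

/-- Bookkeeping: TEAM B's global edge, isolated. [folklore] -/
theorem teamA_edge_of_globalVolumeTransport (H : BridgeHyps P) (hadm : ThetaRegionsAdm P) {O : Obs → Prop}
    (hread : O .constitutesConstruction → GlobalVolumeTransport P) :
    O .constitutesConstruction → P.Statement :=
  fun hc => (hread hc).statement_of H hadm

end Cor312Proof

end IUTFork

end Summit.ABC
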